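import Literature.AnabelianGeometry.AbsoluteAnabelian.MLFGaloisGroupsHolds
import Literature.AnabelianGeometry.AbsoluteAnabelian.AbsAnabCoinvariantRankProofs
import HarnessLib

/-!
# [AbsTopI] Thm 2.6 (ii) AS TYPED (`FundamentalExtension.Thm26ii`) from its printed inputs, case `Σ ⊇ Primes`

S. Mochizuki, *Topics in Absolute Anabelian Geometry I: Generalities* (2012) [AbsTopI], Thm 2.6
(ii), manuscript p. 21 (lit key `paper:url-11ac98ba15fc`), proof p. 23 ll. 11–22:

  "To verify assertion (ii), let us first observe that the topological finite generation of `Π`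
   follows from that of `Δ` [cf. Proposition 2.2], together with that of `G` [cf. [NSW], Theorem
   7.5.10]. [...] Moreover, the existence of a rational point of `A` over some finite extension of
   `k` [which determines a Galois section of the étale fundamental group of `A` over some open
   subgroup of `G`] implies that `δ¹_l(Π) = δ¹_l(G) + dim_{ℚ_l}(Q_l ⊗ ℚ_l)` [where we recall that
   `dim_{ℚ_l}(Q_l ⊗ ℚ_l)` is independent of `l`] for `l ∈ Σ`".

Proof-only companion (no definitions, no named facts).  abc-iut-L4-t11's `thm26ii_of_clauses`
(`MLFGaloisGroupsHolds.lean`) reduces the typed predicate `E.Thm26ii B S` — unconditionally in its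
`G`-clauses and "`ε¹_p(Π) = ∞`" (abc-iut-L4-t4's rank formula `thm26_ii_delta_gal_holds`) — to three
`Π`-clauses: `Π` topologically finitely generated; `δ¹_l(Π) = δ¹_l(G)` for `l ∉ Σ`;
`δ¹_l(Π) − δ¹_l(G)` independent of `l ∈ Σ`.  HERE those clauses are derived, for every extension
with MLF base data and `Σ ⊇ Primes` (the case of [IUTchI–III], where the full profinite `π₁` is
used; then the second clause is vacuous), from the PRINTED inputs by name:
* `Δ` topologically finitely generated — [AbsTopI] Prop 2.2, `E.GeomTFG`;
* `G` topologically finitely generated — "[NSW], Theorem 7.5.10" for `G ≅ G_k`, `k` an MLF; a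
  HYPOTHESIS `IsTopologicallyFinitelyGenerated E.gal` in existing vocabulary (not an [IUTchI–IV]-cited
  item; GAP-LEDGER row G-L4t4-2 of abc-iut-L4-t4), used only for the first clause;
* "the existence of a rational point of `A` over some finite extension of `k`" — abc-iut-L4-t4's
  `E.SplitsOverOpenSubgroup` ([AbsAnab] §1.1), and the `Ẑ`-module structure of the `G`-coinvariant
  torsion-free quotient of `Δ^{ab}` — `E.StarCondition` ([AbsAnab] Lemma 1.1.4 (ii) (∗)), which
  together give `δ¹_l(Π) = δ¹_l(G) + m` for one `m` and all `l` (abc-iut-L4-d3's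
  `exists_freeProlRank_open_eq_add`, the kernel version of "`dim_{ℚ_l}(Q_l ⊗ ℚ_l)` is independent of
  `l`").
HONEST FRAMING: [AbsTopI] is a refereed, undisputed paper; nothing here bears on [IUTchIII]
Cor. 3.12; typed ≠ proved elsewhere; the inputs stay explicit hypotheses.
-/

noncomputable section

open Topology

namespace Literature.AnabelianGeometry.AbsoluteAnabelian

namespace FundamentalExtension

universe u

section Transport

variable {G : Type u} [Group G] [TopologicalSpace G]

/-- A subgroup equal to `⊤` is bicontinuously isomorphic to the ambient group. [folklore] -/
private theorem nonempty_continuousMulEquiv_of_eq_top (K : Subgroup G) (h : K = ⊤) :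
    Nonempty (K ≃ₜ* G) :=
  ⟨{ toFun := fun x => (x : G)
     invFun := fun g => ⟨g, h ▸ Subgroup.mem_top g⟩
     left_inv := fun _ => rfl
     right_inv := fun _ => rfl
     map_mul' := fun _ _ => rfl
     continuous_toFun := continuous_subtype_val
     continuous_invFun := Continuous.subtype_mk continuous_id _ }⟩

end Transport

variable (E : FundamentalExtension.{u})

/-- **"`δ¹_l(Π) = δ¹_l(G) + dim_{ℚ_l}(Q_l ⊗ ℚ_l)`, independent of `l`"** (proof of Thm 2.6 (ii),
p. 23), for an abstract extension that splits over an open subgroup of `G` and satisfies (∗): there is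
ONE `m : ℕ` with `δ¹_l(Π) = δ¹_l(G) + m` for every prime `l` — abc-iut-L4-d3's
`exists_freeProlRank_open_eq_add` at `Π′ = Π`, transported along `Π ≅ ⊤ ⊆ Π` and `G = aug(Π)`.
[cite: MochizukiAbsTopI2012, Thm 2.6 (ii) p.21] -/
theorem exists_freeProlRank_arith_eq_gal_add (hs : E.SplitsOverOpenSubgroup) (hstar : E.StarCondition) :
    ∃ m : ℕ, ∀ (l : ℕ) [Fact l.Prime], freeProlRank E.arith l = freeProlRank E.gal l + m := by
  obtain ⟨m, hm⟩ := E.exists_freeProlRank_open_eq_add hs hstar ⊤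
    (by rw [Subgroup.coe_top]; exact isOpen_univ)
  refine ⟨m, fun l _ => ?_⟩
  obtain ⟨e₁⟩ := nonempty_continuousMulEquiv_of_eq_top (⊤ : Subgroup E.arith) rfl
  obtain ⟨e₂⟩ := nonempty_continuousMulEquiv_of_eq_top ((⊤ : Subgroup E.arith).map E.aug.toMonoidHom)
    (Subgroup.map_top_of_surjective _ E.aug_surjective)
  have h1 : freeProlRank (⊤ : Subgroup E.arith) l = freeProlRank E.arith l :=
    freeProlRank_eq_of_continuousMulEquiv e₁ l
  have h2 : freeProlRank ((⊤ : Subgroup E.arith).map E.aug.toMonoidHom) l = freeProlRank E.gal l :=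
    freeProlRank_eq_of_continuousMulEquiv e₂ l
  rw [← h1, hm l, h2]

/-- `δ¹_l(G) < ∞` for every prime `l`, for an extension with MLF base data `G ≅ G_k` — from the
theorem "`δ¹_l(G) = 1` (`l ≠ p`), `δ¹_p(G) = [k : ℚ_p] + 1`" (abc-iut-L4-t11's `freeProlRank_gal`,
on abc-iut-L4-t4's rank formula). [cite: MochizukiAbsTopI2012, Thm 2.6 (ii) p.21] -/
theorem freeProlRank_gal_ne_top {E : FundamentalExtension.{0}} (B : E.MLFBase) (l : ℕ) [Fact l.Prime] :
    freeProlRank E.gal l ≠ ⊤ := by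
  by_cases hl : l = B.p
  · subst hl
    have h := (freeProlRank_gal B).2
    exact ne_of_eq_of_ne h (ENat.coe_ne_top _)
  · rw [(freeProlRank_gal B).1 l hl]
    exact ENat.one_ne_top

/-- **[AbsTopI] Thm 2.6 (ii) AS TYPED, case `Σ ⊇ Primes`**, the printed deduction kernel-checked for
EVERY extension `1 → Δ → Π → G → 1` with MLF base data `G ≅ G_k`: GIVEN
(a) `Δ` topologically finitely generated ([AbsTopI] Prop 2.2, `E.GeomTFG`),
(b) `G` topologically finitely generated ("[NSW], Theorem 7.5.10"; hypothesis),
(c) a splitting over an open subgroup of `G` ("the existence of a rational point of `A` over some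
    finite extension of `k`", `E.SplitsOverOpenSubgroup`) and
(d) condition (∗) of [AbsAnab] Lemma 1.1.4 (ii) (`E.StarCondition`, the `Ẑ`-freeness of the
    `G`-trivial torsion-free quotient of `Δ^{ab}`),
the predicate `E.Thm26ii B S` holds for every `S ⊇ Primes`: `Π` is topologically finitely generated;
`δ¹_l(G) = 1` (`l ≠ p`), `δ¹_p(G) = [k : ℚ_p] + 1`; `δ¹_l(Π) − δ¹_l(G)` is independent of `l ∈ Σ`
(the clause "`= 0` if `l ∉ Σ`" being vacuous); `ε¹_p(Π) = ∞`.
[cite: MochizukiAbsTopI2012, Thm 2.6 (ii) p.21] -/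
theorem thm26ii_of_starCondition {E : FundamentalExtension.{0}} (B : E.MLFBase) (S : Set ℕ)
    (hS : ∀ l : ℕ, l.Prime → l ∈ S) (hΔ : E.GeomTFG) (hG : IsTopologicallyFinitelyGenerated E.gal)
    (hs : E.SplitsOverOpenSubgroup) (hstar : E.StarCondition) : E.Thm26ii B S := by
  refine thm26ii_of_clauses B S ?_ ?_ ?_
  · exact IsTopologicallyFinitelyGenerated.of_extension E.aug E.aug_surjective hΔ hG
  · intro l hl hlS
    exact absurd (hS l hl.out) hlS
  · intro l₁ l₂ _ _ _ _
    obtain ⟨m, hm⟩ := E.exists_freeProlRank_arith_eq_gal_add hs hstar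
    rw [hm l₁, hm l₂,
      (ENat.addLECancellable_of_ne_top (freeProlRank_gal_ne_top B l₁)).add_tsub_cancel_left,
      (ENat.addLECancellable_of_ne_top (freeProlRank_gal_ne_top B l₂)).add_tsub_cancel_left]

/-- The `Π`-clause "`δ¹_l(Π) − δ¹_l(G)` is independent of `l`" ALONE needs neither finite generation
hypothesis: for every extension with MLF base data that splits over an open subgroup of `G` and
satisfies (∗), `δ¹_{l₁}(Π) − δ¹_{l₁}(G) = δ¹_{l₂}(Π) − δ¹_{l₂}(G)` for all primes `l₁, l₂`.
[cite: MochizukiAbsTopI2012, Thm 2.6 (ii) p.21] -/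
theorem freeProlRank_arith_sub_gal_const {E : FundamentalExtension.{0}} (B : E.MLFBase)
    (hs : E.SplitsOverOpenSubgroup) (hstar : E.StarCondition)
    (l₁ l₂ : ℕ) [Fact l₁.Prime] [Fact l₂.Prime] :
    freeProlRank E.arith l₁ - freeProlRank E.gal l₁ =
      freeProlRank E.arith l₂ - freeProlRank E.gal l₂ := by
  obtain ⟨m, hm⟩ := E.exists_freeProlRank_arith_eq_gal_add hs hstar
  rw [hm l₁, hm l₂,
    (ENat.addLECancellable_of_ne_top (freeProlRank_gal_ne_top B l₁)).add_tsub_cancel_left,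
    (ENat.addLECancellable_of_ne_top (freeProlRank_gal_ne_top B l₂)).add_tsub_cancel_left]

end FundamentalExtension

end Literature.AnabelianGeometry.AbsoluteAnabelian
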